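import Summits.RiemannHypothesis.RiemannHypothesis.Theses.NymanBeurling
import Summits.RiemannHypothesis.RiemannHypothesis.Theorems.NymanBeurlingNbThesisIntegrable
import Summits.RiemannHypothesis.RiemannHypothesis.Theorems.NymanBeurlingNbThesisLowerBound

/-!
# RiemannHypothesis / NymanBeurling — normal forms of crux #2 `NbRateLog`

Route `RiemannHypothesis/NymanBeurling`, crux #2 `NbRateLog` (item stmt-RiemannHypothesis-0394):

  `∃ C, ∀ N ≥ 2, ∃ a : Fin N → ℂ, ∫⁻ ‖1 - ζ(1/2+it) Σ_{k<N} a_k (k+1)^{-(1/2+it)}‖² dt/(1/4+t²) ≤ C / log N`.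

Writing `D N := ⨅_a ∫ ‖1 - ζA‖²/(1/4+t²)` for the infimum of the (real, finite:
`Theorems/NymanBeurlingNbThesisIntegrable.lean`) distance integrals over all length-`N` Dirichlet
polynomials — `D N = 2π d_N²` in the notation of Báez-Duarte–Balazard–Landreau–Saias and
Bettin–Conrey–Farmer — this file proves, unconditionally, that the crux is exactly the printed
conjecture "`d_N² ≪ 1/log N`" and that its two cosmetic features carry no extra difficulty:

* `nbRateLog_const_pos` — any admissible constant is `> 0` (indeed `≥` the BDBLS constant,
  `le_const_of_nbRateBound`);
* `nbRateLog_iff_iInf` — `NbRateLog ↔ ∃ C, ∀ N ≥ 2, D N ≤ C / log N` (the `∃ a` form and the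
  infimum form agree: the infimum need not be attained, one pays `C ↦ C + 1`);
* `nbRateLog_iff_eventually` — `NbRateLog ↔ ∃ C, ∀ᶠ N, ∃ a, ∫⁻ … ≤ C / log N` ("one `C` for all
  `N ≥ 2`" is free: finitely many `N` are absorbed by `D N ≤ 2π`, testing the zero polynomial);
* `nbRateLog_iff_isBigO` — `NbRateLog ↔ D =O[atTop] (1 / log)`, i.e. literally `d_N² ≪ 1/log N`
  [BDBLS2000 conjecture in `O`-form; BettinConreyFarmer2013 §1].

References: L. Báez-Duarte, M. Balazard, B. Landreau, E. Saias, Adv. Math. 149 (2000) 130–144;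
S. Bettin, J. B. Conrey, D. W. Farmer, Proc. Steklov Inst. 280 (2013), §1; J.-F. Burnol, Adv. Math.
170 (2002), Thm. 1.3.
-/

noncomputable section

open Complex Filter Topology MeasureTheory Asymptotics
open scoped Real ENNReal

namespace Summit.RiemannHypothesis.RiemannHypothesis.Theorems

open Summit.RiemannHypothesis.RiemannHypothesis.Theses.NymanBeurling

/-- With all coefficients `0` the `∫⁻` of the thesis integrand is `ENNReal.ofReal (2π)`
(the integrand is `1/(1/4+t²)`). [folklore] -/
theorem nb_lintegral_zero_coeff (N : ℕ) :
    ∫⁻ t : ℝ, ENNReal.ofReal (‖1 - riemannZeta (1 / 2 + t * I) *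
        ∑ n : Fin N, (0 : Fin N → ℂ) n * ((n : ℂ) + 1) ^ (-(1 / 2 + t * I))‖ ^ 2 / (1 / 4 + t ^ 2)) =
      ENNReal.ofReal (2 * π) := by
  rw [nb_lintegral_eq_ofReal_integral, nb_integral_zero_coeff]

/-- For `N ≥ 2` (as naturals) `log N > 0`. [folklore] -/
theorem nb_log_pos {N : ℕ} (hN : 2 ≤ N) : 0 < Real.log (N : ℝ) :=
  Real.log_pos (by exact_mod_cast Nat.lt_of_lt_of_le one_lt_two hN)

/-- A `∫⁻ ≤ ENNReal.ofReal r` bound on the thesis integrand with `0 ≤ r` is the real bound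
`∫ ≤ r`. [folklore] -/
theorem nb_integral_le_of_lintegral_le {N : ℕ} (a : Fin N → ℂ) {r : ℝ} (hr : 0 ≤ r)
    (h : ∫⁻ t : ℝ, ENNReal.ofReal (‖1 - riemannZeta (1 / 2 + t * I) *
        ∑ n : Fin N, a n * ((n : ℂ) + 1) ^ (-(1 / 2 + t * I))‖ ^ 2 / (1 / 4 + t ^ 2)) ≤
      ENNReal.ofReal r) :
    ∫ t : ℝ, ‖1 - riemannZeta (1 / 2 + t * I) *
        ∑ n : Fin N, a n * ((n : ℂ) + 1) ^ (-(1 / 2 + t * I))‖ ^ 2 / (1 / 4 + t ^ 2) ≤ r := by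
  rwa [nb_lintegral_eq_ofReal_integral, ENNReal.ofReal_le_ofReal_iff hr] at h

/-- A strict real bound `∫ < r` on the thesis integrand gives `∫⁻ ≤ ENNReal.ofReal r`.
[folklore] -/
theorem nb_lintegral_le_of_integral_lt {N : ℕ} (a : Fin N → ℂ) {r : ℝ}
    (h : ∫ t : ℝ, ‖1 - riemannZeta (1 / 2 + t * I) *
        ∑ n : Fin N, a n * ((n : ℂ) + 1) ^ (-(1 / 2 + t * I))‖ ^ 2 / (1 / 4 + t ^ 2) < r) :
    ∫⁻ t : ℝ, ENNReal.ofReal (‖1 - riemannZeta (1 / 2 + t * I) *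
        ∑ n : Fin N, a n * ((n : ℂ) + 1) ^ (-(1 / 2 + t * I))‖ ^ 2 / (1 / 4 + t ^ 2)) ≤
      ENNReal.ofReal r := by
  rw [nb_lintegral_eq_ofReal_integral]
  exact ENNReal.ofReal_le_ofReal h.le

/-- **Admissible constants are positive.** If `C` works in `NbRateLog` (for every `N ≥ 2` some
length-`N` polynomial has `∫⁻ … ≤ C/log N`), then `0 < C` — in fact `C` is at least the
Báez-Duarte–Balazard–Landreau–Saias constant (`le_const_of_nbRateBound`). [BDBLS2000] -/
theorem nbRateLog_const_pos {C : ℝ}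
    (hC : ∀ N : ℕ, 2 ≤ N → ∃ a : Fin N → ℂ, ∫⁻ t : ℝ, ENNReal.ofReal (‖1 - riemannZeta (1 / 2 + t * I) *
        ∑ n : Fin N, a n * ((n : ℂ) + 1) ^ (-(1 / 2 + t * I))‖ ^ 2 / (1 / 4 + t ^ 2)) ≤
      ENNReal.ofReal (C / Real.log N)) :
    0 < C := by
  obtain ⟨C₀, hC₀, h⟩ := le_const_of_nbRateBound
  exact hC₀.trans_le (h C hC)

/-- **`NbRateLog` in `d_N` form.** Crux #2 holds iff one constant `C` bounds the infimum
`D N = ⨅_a ∫ ‖1 - ζA‖²/(1/4+t²)` (`= 2π d_N²`) by `C / log N` for every `N ≥ 2`. (`⇒`: the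
infimum is below any witness; `⇐`: the infimum is `< (C+1)/log N`, so some polynomial beats
`(C+1)/log N`.) [BettinConreyFarmer2013, §1 (the `d_N` normalisation)] -/
theorem nbRateLog_iff_iInf :
    NbRateLog ↔ ∃ C : ℝ, ∀ N : ℕ, 2 ≤ N →
      (⨅ a : Fin N → ℂ, ∫ t : ℝ, ‖1 - riemannZeta (1 / 2 + t * I) *
        ∑ n : Fin N, a n * ((n : ℂ) + 1) ^ (-(1 / 2 + t * I))‖ ^ 2 / (1 / 4 + t ^ 2)) ≤
        C / Real.log N := by
  unfold NbRateLog
  constructor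
  · rintro ⟨C, hC⟩
    have hCpos : 0 < C := nbRateLog_const_pos hC
    refine ⟨C, fun N hN ↦ ?_⟩
    obtain ⟨a, ha⟩ := hC N hN
    exact (ciInf_le (nb_bddBelow_range N) a).trans
      (nb_integral_le_of_lintegral_le a (div_nonneg hCpos.le (nb_log_pos hN).le) ha)
  · rintro ⟨C, hC⟩
    refine ⟨C + 1, fun N hN ↦ ?_⟩
    have hlt : (⨅ a : Fin N → ℂ, ∫ t : ℝ, ‖1 - riemannZeta (1 / 2 + t * I) *
        ∑ n : Fin N, a n * ((n : ℂ) + 1) ^ (-(1 / 2 + t * I))‖ ^ 2 / (1 / 4 + t ^ 2)) <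
        (C + 1) / Real.log N :=
      (hC N hN).trans_lt ((div_lt_div_iff_of_pos_right (nb_log_pos hN)).mpr (lt_add_one C))
    obtain ⟨a, ha⟩ := (ciInf_lt_iff (nb_bddBelow_range N)).mp hlt
    exact ⟨a, nb_lintegral_le_of_integral_lt a ha⟩

/-- **"One constant for all `N ≥ 2`" is free.** Crux #2 holds iff some constant works for all
sufficiently large `N`: the finitely many remaining `N ≥ 2` are absorbed by enlarging the constant
to `max C (2π log N₀)`, testing the zero polynomial (`∫⁻ = 2π`, `nb_lintegral_zero_coeff`).
[folklore] -/
theorem nbRateLog_iff_eventually :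
    NbRateLog ↔ ∃ C : ℝ, ∀ᶠ N : ℕ in atTop, ∃ a : Fin N → ℂ,
      ∫⁻ t : ℝ, ENNReal.ofReal (‖1 - riemannZeta (1 / 2 + t * I) *
        ∑ n : Fin N, a n * ((n : ℂ) + 1) ^ (-(1 / 2 + t * I))‖ ^ 2 / (1 / 4 + t ^ 2)) ≤
        ENNReal.ofReal (C / Real.log N) := by
  unfold NbRateLog
  constructor
  · rintro ⟨C, hC⟩
    exact ⟨C, (eventually_ge_atTop 2).mono fun N hN ↦ hC N hN⟩
  · rintro ⟨C, hC⟩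
    obtain ⟨N₀, hN₀⟩ := eventually_atTop.mp hC
    refine ⟨max C (2 * π * Real.log (N₀ : ℝ)), fun N hN ↦ ?_⟩
    have hlog : 0 < Real.log (N : ℝ) := nb_log_pos hN
    rcases le_or_gt N₀ N with hle | hlt
    · obtain ⟨a, ha⟩ := hN₀ N hle
      refine ⟨a, ha.trans (ENNReal.ofReal_le_ofReal ?_)⟩
      exact div_le_div_of_nonneg_right (le_max_left _ _) hlog.le
    · refine ⟨0, ?_⟩
      rw [nb_lintegral_zero_coeff]
      refine ENNReal.ofReal_le_ofReal ((le_div_iff₀ hlog).mpr ?_)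
      have hNN₀ : Real.log (N : ℝ) ≤ Real.log (N₀ : ℝ) :=
        Real.log_le_log (by exact_mod_cast Nat.lt_of_lt_of_le two_pos hN) (by exact_mod_cast hlt.le)
      calc 2 * π * Real.log (N : ℝ) ≤ 2 * π * Real.log (N₀ : ℝ) :=
            mul_le_mul_of_nonneg_left hNN₀ (by positivity)
        _ ≤ max C (2 * π * Real.log (N₀ : ℝ)) := le_max_right _ _

/-- **`NbRateLog` is literally `d_N² ≪ 1/log N`.** Crux #2 holds iff
`D N = ⨅_a ∫ ‖1 - ζA‖²/(1/4+t²)` (`= 2π d_N²`) is `O(1/log N)` as `N → ∞` — the `O`-form of the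
Báez-Duarte–Balazard–Landreau–Saias conjecture `d_N² ~ (2 + γ - log 4π)/log N`.
[BDBLS2000 (conjecture, `O`-form); BettinConreyFarmer2013, §1] -/
theorem nbRateLog_iff_isBigO :
    NbRateLog ↔ (fun N : ℕ ↦ ⨅ a : Fin N → ℂ, ∫ t : ℝ, ‖1 - riemannZeta (1 / 2 + t * I) *
        ∑ n : Fin N, a n * ((n : ℂ) + 1) ^ (-(1 / 2 + t * I))‖ ^ 2 / (1 / 4 + t ^ 2)) =O[atTop]
      fun N : ℕ ↦ (Real.log (N : ℝ))⁻¹ := by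
  constructor
  · intro h
    obtain ⟨C, hC⟩ := nbRateLog_iff_iInf.mp h
    refine isBigO_iff.mpr ⟨|C|, (eventually_ge_atTop 2).mono fun N hN ↦ ?_⟩
    have hlog : 0 < Real.log (N : ℝ) := nb_log_pos hN
    rw [Real.norm_eq_abs, Real.norm_eq_abs, abs_of_nonneg (nb_dist_nonneg N),
      abs_of_pos (inv_pos.mpr hlog), ← div_eq_mul_inv]
    exact (hC N hN).trans (div_le_div_of_nonneg_right (le_abs_self C) hlog.le)
  · intro h
    obtain ⟨c, hc⟩ := isBigO_iff.mp h
    refine nbRateLog_iff_eventually.mpr ⟨c + 1, ?_⟩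
    filter_upwards [hc, eventually_ge_atTop 2] with N hN hN2
    have hlog : 0 < Real.log (N : ℝ) := nb_log_pos hN2
    rw [Real.norm_eq_abs, Real.norm_eq_abs, abs_of_nonneg (nb_dist_nonneg N),
      abs_of_pos (inv_pos.mpr hlog), ← div_eq_mul_inv] at hN
    have hlt : (⨅ a : Fin N → ℂ, ∫ t : ℝ, ‖1 - riemannZeta (1 / 2 + t * I) *
        ∑ n : Fin N, a n * ((n : ℂ) + 1) ^ (-(1 / 2 + t * I))‖ ^ 2 / (1 / 4 + t ^ 2)) <
        (c + 1) / Real.log N :=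
      hN.trans_lt ((div_lt_div_iff_of_pos_right hlog).mpr (lt_add_one c))
    obtain ⟨a, ha⟩ := (ciInf_lt_iff (nb_bddBelow_range N)).mp hlt
    exact ⟨a, nb_lintegral_le_of_integral_lt a ha⟩

end Summit.RiemannHypothesis.RiemannHypothesis.Theorems

end
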